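import Summits.QuantumFields.YangMills.Theorems.VirialFluxGapSharpTwistedLaplaceQuantitativeLaplaceSmooth
import HarnessLib

/-!
# The window phase datum `f = ½⟪Ay,y⟫ + c + r` from a «quadratic − odd cubic + O(‖y‖⁴)» model, by odd/even splitting
# (generic front-end lemma for the assembly (item (d)) of the DIRECT Laplace road to ⟨stmt-QuantumFields-24204⟩ `VirialFluxGap.SharpTwistedLaplace`)

Helper module (free-hands work of width seat ym-line-sfw-p2-w2 g50, cell ym-idea-1; `--supports 24204`).  The Euclidean core
✓`QuantitativeLaplace.laplaceMethod_quantitative_of_eqOn` (and the orbit theorem built on it) takes the phase in the form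
`F(y) = ½⟪Ay,y⟫ + c(y) + r(y)` on `‖y‖ ≤ R` with `c` ODD, `|c(y)| ≤ A₃‖y‖³`, `|r(y)| ≤ A₄‖y‖⁴`, `c, r` measurable.  The chart delivers instead a MODEL
`|F(y) − (Q(y) − C(y))| ≤ E₄‖y‖⁴` with `Q(y) = ½⟪Ay,y⟫` and `C` odd, `|C(y)| ≤ E₃‖y‖³` (✓`ChartPhase.abs_ringDeficit_sub_chartModel_le` along a linear slice,
with ✓`inner_sumSq_operator` for `Q`).  The canonical choice
  `c(y) := (F(y) − F(−y))/2`,   `r(y) := (F(y) + F(−y))/2 − ½⟪Ay,y⟫`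
does it: ★ `window_phase_data_of_model` — `F = ½⟪Ay,y⟫ + c + r` (identically), `c` odd, `|c(y)| ≤ (E₃ + E₄R)‖y‖³` and `|r(y)| ≤ E₄‖y‖⁴` on `‖y‖ ≤ R`;
`measurable_oddPart`, `measurable_evenRemainder`.  Everything here is PROVED; no definitions, no named facts (namespace
`Summit.QuantumFields.YangMills.Theorems.QuantitativeLaplace`).

HONEST FRAMING: elementary; ⟨24204⟩, ⟨24319⟩, ⟨22884⟩ and every rung stay OPEN; the Yang–Mills mass gap (Clay) is NOT touched; no summit is proved by a line.

## References
* K. W. Breitung, *Asymptotic Approximations for Probability Integrals*, LNM 1592 (1994), Lemma 7 p. 12 (parity of the Taylor terms). [Breitung1994]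
-/

set_option autoImplicit false

noncomputable section

open scoped RealInnerProductSpace

namespace Summit.QuantumFields.YangMills.Theorems.QuantitativeLaplace

variable {V : Type*} [NormedAddCommGroup V] [InnerProductSpace ℝ V]

omit [InnerProductSpace ℝ V] in
/-- The odd part of a measurable function is measurable. [folklore] -/
theorem measurable_oddPart [MeasurableSpace V] [BorelSpace V] {F : V → ℝ} (hF : Measurable F) :
    Measurable fun y : V => (F y - F (-y)) / 2 :=
  (hF.sub (hF.comp measurable_neg)).div_const 2

/-- The even remainder is measurable. [folklore] -/
theorem measurable_evenRemainder [MeasurableSpace V] [BorelSpace V] [SecondCountableTopology V] {F : V → ℝ} (hF : Measurable F)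
    (A : V →L[ℝ] V) : Measurable fun y : V => (F y + F (-y)) / 2 - (1 / 2) * ⟪A y, y⟫ :=
  ((hF.add (hF.comp measurable_neg)).div_const 2).sub ((A.continuous.inner continuous_id).measurable.const_mul _)

/-- ★ **Window phase datum from a «quadratic − odd cubic + quartic» model.**  If `|F(y) − (½⟪Ay,y⟫ − C(y))| ≤ E₄‖y‖⁴` on `‖y‖ ≤ R` with `C` odd,
`|C(y)| ≤ E₃‖y‖³` there, then with `c(y) = (F(y) − F(−y))/2`, `r(y) = (F(y) + F(−y))/2 − ½⟪Ay,y⟫`: `F = ½⟪Ay,y⟫ + c + r`,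
`c(−y) = −c(y)`, `|c(y)| ≤ (E₃ + E₄R)‖y‖³`, `|r(y)| ≤ E₄‖y‖⁴` on the ball. [cite: Breitung1994, Lemma 7 p. 12] -/
theorem window_phase_data_of_model {F C : V → ℝ} (A : V →ₗ[ℝ] V) {E₃ E₄ R : ℝ} (hE₄ : 0 ≤ E₄)
    (hCodd : ∀ y, C (-y) = -C y) (hC : ∀ y : V, ‖y‖ ≤ R → |C y| ≤ E₃ * ‖y‖ ^ 3)
    (hmodel : ∀ y : V, ‖y‖ ≤ R → |F y - ((1 / 2) * ⟪A y, y⟫ - C y)| ≤ E₄ * ‖y‖ ^ 4) :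
    (∀ y : V, F y = (1 / 2) * ⟪A y, y⟫ + (F y - F (-y)) / 2 + ((F y + F (-y)) / 2 - (1 / 2) * ⟪A y, y⟫)) ∧
      (∀ y : V, (F (-y) - F (- -y)) / 2 = -((F y - F (-y)) / 2)) ∧
      (∀ y : V, ‖y‖ ≤ R → |(F y - F (-y)) / 2| ≤ (E₃ + E₄ * R) * ‖y‖ ^ 3) ∧
      (∀ y : V, ‖y‖ ≤ R → |(F y + F (-y)) / 2 - (1 / 2) * ⟪A y, y⟫| ≤ E₄ * ‖y‖ ^ 4) := by
  have hAneg : ∀ y : V, ⟪A (-y), -y⟫ = ⟪A y, y⟫ := fun y => by rw [map_neg, inner_neg_left, inner_neg_right, neg_neg]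
  refine ⟨fun y => by ring, fun y => by rw [neg_neg]; ring, fun y hy => ?_, fun y hy => ?_⟩
  · have hy' : ‖-y‖ ≤ R := by rwa [norm_neg]
    have h1 := hmodel y hy
    have h2 := hmodel (-y) hy'
    rw [hAneg, hCodd, norm_neg] at h2
    have h3 := hC y hy
    have hn0 : 0 ≤ ‖y‖ := norm_nonneg y
    have hR : ‖y‖ ^ 4 ≤ R * ‖y‖ ^ 3 := by nlinarith [pow_nonneg hn0 3]
    rw [abs_le] at h1 h2 h3 ⊢
    constructor <;> nlinarith [h1.1, h1.2, h2.1, h2.2, h3.1, h3.2, hR, pow_nonneg hn0 3]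
  · have hy' : ‖-y‖ ≤ R := by rwa [norm_neg]
    have h1 := hmodel y hy
    have h2 := hmodel (-y) hy'
    rw [hAneg, hCodd, norm_neg] at h2
    rw [abs_le] at h1 h2 ⊢
    constructor <;> nlinarith [h1.1, h1.2, h2.1, h2.2]

end Summit.QuantumFields.YangMills.Theorems.QuantitativeLaplace
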